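import Literature.AlgebraicGeometry.Motives.ProjectiveIncidence
import Literature.AlgebraicGeometry.Resolution.MacaulayficationCentre
import Literature.AlgebraicGeometry.Resolution.MarkedIdeals
import HarnessLib

/-!
# The centre `∏ᵢ (zᵢ, …, z_d)𝒪_X` of Kawasaki's Cohen–Macaulay blow-up as an ideal sheaf

Topic: `Literature/AlgebraicGeometry/Resolution`. For a scheme `Y` over a field `k` with a
morphism `r : Y → ℙⁿ_k` (for Kawasaki: a closed subvariety) and forms `z₀, …, z_{d-1}` of positive
degrees, Kawasaki 2000, proof of Thm. 5.1 blows up the ideal sheaf `𝔟 = ∏ᵢ (zᵢ, …, z_{d-1})𝒪_Y`.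
This file builds `𝔟` from the hypersurface-section ideal sheaves of the Motives library
(`ProjectiveSpace.secIdealSheaf`, the zero scheme `Sec.zeroIdeal` of the pulled-back section
`r^* z_l`, `Motives/SecZeroScheme.lean`) and computes it:

* `kawasakiCentreSheaf r z N hz : Y.left.IdealSheafData` (lists mirror `kawasakiCenter`);
* `ideal_kawasakiCentreSheaf` — on an affine open `V ⊆ r⁻¹D₊(x_j)` its ideal of sections is
  `kawasakiCenter [z₀/x_j^{N₀}|_V, …]` of the dehomogenized chart values;
* `stalkIdeal_kawasakiCentreSheaf` — its stalk at `x ∈ r⁻¹D₊(x_j)` is `kawasakiCenter` of the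
  germs (Kawasaki: "`𝔟 𝒪_{X,p} = ∏_{i=t}^{d} (z_i, …, z_d)𝒪_{X,p}`" after dropping the units, via
  `map_kawasakiCenter_append_of_isUnit`);
* `mem_support_kawasakiCentreSheaf_iff` — its support is the hypersurface section `V₊(z_{d-1})`;
  `kawasakiCentreSheaf_ne_bot`.

Everything is proved; no named facts.

## References

* T. Kawasaki, *On Macaulayfication of Noetherian schemes*, Trans. AMS 352 (2000): proof of
  Thm. 5.1 (p. 2539). [Kawasaki2000]
-/

noncomputable section

open CategoryTheory AlgebraicGeometry TopologicalSpace MvPolynomial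
open Literature.AlgebraicGeometry.Motives Literature.AlgebraicGeometry.Motives.GeneratingSections

universe u

namespace Literature.AlgebraicGeometry.Resolution

attribute [local instance] MvPolynomial.gradedAlgebra

/-! ## Lists of ideal sheaves: sups and Kawasaki products -/

section Lists

variable {X : Scheme.{u}}

/-- The sup of a list of ideal sheaves. [folklore] -/
def listSup (Ks : List X.IdealSheafData) : X.IdealSheafData := Ks.foldr (· ⊔ ·) ⊥

/-- Unfolding, empty list. [folklore] -/
@[simp] theorem listSup_nil : listSup ([] : List X.IdealSheafData) = ⊥ := rfl

/-- Unfolding, cons. [folklore] -/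
@[simp] theorem listSup_cons (K : X.IdealSheafData) (Ks : List X.IdealSheafData) :
    listSup (K :: Ks) = K ⊔ listSup Ks := rfl

/-- Sections of a list sup. [folklore] -/
theorem ideal_listSup (Ks : List X.IdealSheafData) (U : X.affineOpens) :
    (listSup Ks).ideal U = (Ks.map fun K => K.ideal U).foldr (· ⊔ ·) ⊥ := by
  induction Ks with
  | nil => rfl
  | cons K Ks ih =>
    rw [listSup_cons, Scheme.IdealSheafData.ideal_sup, Pi.sup_apply, List.map_cons, List.foldr_cons, ih]

/-- Support of a list sup. [folklore] -/
theorem mem_support_listSup_iff (Ks : List X.IdealSheafData) (x : X) :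
    x ∈ (listSup Ks).support ↔ ∀ K ∈ Ks, x ∈ K.support := by
  induction Ks with
  | nil =>
    simp only [listSup_nil, Scheme.IdealSheafData.support_bot, List.not_mem_nil, IsEmpty.forall_iff,
      implies_true, iff_true]
    trivial
  | cons K Ks ih =>
    rw [listSup_cons, Scheme.IdealSheafData.support_sup, ← SetLike.mem_coe, Closeds.coe_inf,
      Set.mem_inter_iff, SetLike.mem_coe, SetLike.mem_coe, ih]
    simp

/-- Sections of a list product. [folklore] -/
theorem ideal_listProd (Ks : List X.IdealSheafData) (U : X.affineOpens) :
    Ks.prod.ideal U = (Ks.map fun K => K.ideal U).prod := by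
  induction Ks with
  | nil =>
    rw [List.prod_nil, List.map_nil, List.prod_nil, Scheme.IdealSheafData.one_eq_top,
      Scheme.IdealSheafData.ideal_top, Pi.top_apply, Ideal.one_eq_top]
  | cons K Ks ih =>
    rw [List.prod_cons, Scheme.IdealSheafData.ideal_mul, Pi.mul_apply, List.map_cons, List.prod_cons, ih]

/-- Support of a list product. [folklore] -/
theorem mem_support_listProd_iff (Ks : List X.IdealSheafData) (x : X) :
    x ∈ Ks.prod.support ↔ ∃ K ∈ Ks, x ∈ K.support := by
  induction Ks with
  | nil =>
    simp only [List.prod_nil, Scheme.IdealSheafData.one_eq_top, Scheme.IdealSheafData.support_top,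
      List.not_mem_nil, false_and, exists_false, iff_false]
    intro h
    rw [← SetLike.mem_coe, Closeds.coe_bot] at h
    exact h
  | cons K Ks ih =>
    rw [List.prod_cons, Scheme.IdealSheafData.support_mul, ← SetLike.mem_coe, Closeds.coe_sup,
      Set.mem_union, SetLike.mem_coe, SetLike.mem_coe, ih]
    simp

/-- **Kawasaki's product of a list of ideal sheaves**: `∏_{i < |Ks|} ⨆ (Ks.drop i)` (the sheaf
version of `kawasakiCenter`). [cite: Kawasaki2000, Thm. 4.1] -/
def kawasakiCenterSheaf (Ks : List X.IdealSheafData) : X.IdealSheafData :=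
  ((List.range Ks.length).map fun i => listSup (Ks.drop i)).prod

/-- A sup of principal ideals over a list is the ideal of the list. [folklore] -/
theorem foldr_sup_span_singleton {R : Type*} [CommRing R] (l : List R) :
    (l.map fun a => Ideal.span {a}).foldr (· ⊔ ·) ⊥ = Ideal.ofList l := by
  induction l with
  | nil => simp [Ideal.ofList]
  | cons a l ih =>
    rw [List.map_cons, List.foldr_cons, ih, Ideal.ofList_cons]

/-- **Sections of the Kawasaki product**: if on the affine open `U` each `Ks[l]` has the principal
ideal of sections `(f_l)`, then the Kawasaki product has ideal of sections `kawasakiCenter [f_l]`.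
[cite: Kawasaki2000, proof of Thm. 5.1] -/
theorem ideal_kawasakiCenterSheaf (Ks : List X.IdealSheafData) (U : X.affineOpens) (fs : List Γ(X, U))
    (hlen : Ks.length = fs.length) (h : ∀ (l : ℕ) (hl : l < Ks.length),
      (Ks[l]).ideal U = Ideal.span {fs[l]'(hlen ▸ hl)}) :
    (kawasakiCenterSheaf Ks).ideal U = kawasakiCenter fs := by
  have hmap : Ks.map (fun K => K.ideal U) = fs.map fun a => Ideal.span {a} := by
    apply List.ext_getElem (by simp [hlen])
    intro l h1 h2
    simp only [List.getElem_map]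
    exact h l (by simpa using h1)
  rw [kawasakiCenterSheaf, kawasakiCenter, ideal_listProd, List.map_map, hlen]
  congr 1
  refine List.map_congr_left fun i _ => ?_
  simp only [Function.comp_apply]
  rw [ideal_listSup, show (List.drop i Ks).map (fun K => K.ideal U) = (Ks.map fun K => K.ideal U).drop i
    from List.map_drop, hmap, ← List.map_drop, foldr_sup_span_singleton]

end Lists

/-! ## The centre of forms on a scheme over `ℙⁿ_k` -/

section Forms

open ProjectiveSpace

variable {k : Type u} [Field k] {n : ℕ} {Y : SchemeOver k} (r : Y ⟶ projectiveSpace n k)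
  {d : ℕ} (z : Fin d → MvPolynomial (Fin (n + 1)) k) (N : Fin d → ℕ)
  (hz : ∀ l, (z l).IsHomogeneous (N l))

/-- The hypersurface-section ideal sheaves `(z_l)𝒪_Y` of the forms, as a list. [folklore] -/
def formSheaves : List Y.left.IdealSheafData :=
  List.ofFn fun l => secIdealSheaf r (z l) (N l) (hz l)

/-- There are `d` form sheaves. [folklore] -/
@[simp] theorem length_formSheaves : (formSheaves r z N hz).length = d := by
  simp [formSheaves]

/-- **Kawasaki's centre `𝔟 = ∏_{i} (z_i, …, z_{d-1})𝒪_Y`** as an ideal sheaf.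
[cite: Kawasaki2000, proof of Thm. 5.1] -/
def kawasakiCentreSheaf : Y.left.IdealSheafData :=
  kawasakiCenterSheaf (formSheaves r z N hz)

/-- The chart value `z_l / x_j^{N_l}` of the form `z_l` on `r⁻¹ D₊(x_j)` (the value of the
section `z_l(s)` of `𝒪(N_l)` in the `j`-th chart). [folklore] -/
def chartVal (l : Fin d) (j : Fin (n + 1)) :
    Γ(Y.left, (GeneratingSections.ofHom r.left).U j) :=
  ((GeneratingSections.ofHom r.left).secOfForm Y.hom (z l) (hz l)).val j

variable [IsAffineHom r.left] [QuasiSeparatedSpace Y.left]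

/-- **Sections of the centre over an affine open inside a chart**: `𝔟(V)` is the Kawasaki product
of the restricted chart values. [cite: Kawasaki2000, proof of Thm. 5.1] -/
theorem ideal_kawasakiCentreSheaf (V : Y.left.affineOpens) (j : Fin (n + 1))
    (hV : (V : Y.left.Opens) ≤ (GeneratingSections.ofHom r.left).U j) :
    (kawasakiCentreSheaf r z N hz).ideal V =
      kawasakiCenter (List.ofFn fun l => rs hV (chartVal r z N hz l j)) := by
  haveI : @IsAffineHom Y.left (Proj (Segre.grading (Fin (n + 1)) k)) r.left := ‹IsAffineHom r.left›
  refine ideal_kawasakiCenterSheaf _ V _ (by simp) fun l hl => ?_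
  simp only [formSheaves, List.getElem_ofFn]
  exact GeneratingSections.Sec.ideal_zeroIdeal _
    (GeneratingSections.isAffineOpen_ofHom_U r.left) V hV

/-- **The stalk of the centre** at a point of the chart `r⁻¹ D₊(x_j)` is the Kawasaki product of
the germs of the chart values (Kawasaki: `𝔟 𝒪_{X,p} = ∏ (z_i, …, z_d) 𝒪_{X,p}`; the unit factors
are dropped by `map_kawasakiCenter_append_of_isUnit`). [cite: Kawasaki2000, proof of Thm. 5.1] -/
theorem stalkIdeal_kawasakiCentreSheaf {x : Y.left} (j : Fin (n + 1))
    (hx : x ∈ (GeneratingSections.ofHom r.left).U j) :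
    stalkIdeal (kawasakiCentreSheaf r z N hz) x =
      kawasakiCenter (List.ofFn fun l =>
        (Y.left.presheaf.germ ((GeneratingSections.ofHom r.left).U j) x hx).hom (chartVal r z N hz l j)) := by
  haveI : @IsAffineHom Y.left (Proj (Segre.grading (Fin (n + 1)) k)) r.left := ‹IsAffineHom r.left›
  rw [stalkIdeal_eq_map_germ _ ⟨(GeneratingSections.ofHom r.left).U j,
      GeneratingSections.isAffineOpen_ofHom_U r.left j⟩ hx,
    ideal_kawasakiCentreSheaf r z N hz _ j le_rfl, kawasakiCenter_map, List.map_ofFn]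
  congr 1
  refine congrArg List.ofFn (funext fun l => ?_)
  simp only [Function.comp_apply, rs_refl]

/-- **The support of the centre is the hypersurface section `V₊(z_{d-1})`** (the last factor
`(z_{d-1})` has the largest support). [cite: Kawasaki2000, proof of Thm. 5.1] -/
theorem mem_support_kawasakiCentreSheaf_iff (hd : 0 < d) (hN : 0 < N ⟨d - 1, by omega⟩)
    (x : Y.left) :
    x ∈ (kawasakiCentreSheaf r z N hz).support ↔ z ⟨d - 1, by omega⟩ ∈ (r.left x).asHomogeneousIdeal := by
  rw [kawasakiCentreSheaf, kawasakiCenterSheaf, mem_support_listProd_iff]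
  have hlast : ∀ i < d, secIdealSheaf r (z ⟨d - 1, by omega⟩) (N ⟨d - 1, by omega⟩) (hz _) ∈
      (formSheaves r z N hz).drop i := by
    intro i hi
    rw [formSheaves, List.mem_iff_getElem]
    refine ⟨d - 1 - i, by simp; omega, ?_⟩
    simp only [List.getElem_drop, List.getElem_ofFn]
    congr 2 <;> (ext; simp; omega)
  constructor
  · rintro ⟨K, hK, hxK⟩
    obtain ⟨i, hi, rfl⟩ := List.mem_map.mp hK
    rw [List.mem_range, length_formSheaves] at hi
    have := (mem_support_listSup_iff _ x).mp hxK _ (hlast i hi)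
    exact (mem_support_secIdealSheaf_iff r _ hN _ x).mp this
  · intro h
    refine ⟨listSup ((formSheaves r z N hz).drop (d - 1)), List.mem_map.mpr ⟨d - 1, ?_, rfl⟩, ?_⟩
    · rw [List.mem_range, length_formSheaves]; omega
    · rw [mem_support_listSup_iff]
      intro K hK
      obtain ⟨m, hm, rfl⟩ := List.mem_iff_getElem.mp hK
      have hm0 : m = 0 := by
        rw [List.length_drop, length_formSheaves] at hm; omega
      subst hm0
      simp only [List.getElem_drop, formSheaves, List.getElem_ofFn, Nat.add_zero]
      exact (mem_support_secIdealSheaf_iff r _ hN _ x).mpr h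

/-- **The centre is a non-zero ideal sheaf** as soon as `z_{d-1}` does not vanish at some point.
[folklore] -/
theorem kawasakiCentreSheaf_ne_bot (hd : 0 < d) (hN : 0 < N ⟨d - 1, by omega⟩)
    (h : ∃ x : Y.left, z ⟨d - 1, by omega⟩ ∉ (r.left x).asHomogeneousIdeal) :
    kawasakiCentreSheaf r z N hz ≠ ⊥ := by
  obtain ⟨x, hx⟩ := h
  intro hbot
  apply hx
  rw [← mem_support_kawasakiCentreSheaf_iff r z N hz hd hN x, hbot, Scheme.IdealSheafData.support_bot]
  trivial

end Forms

end Literature.AlgebraicGeometry.Resolution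

end
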